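import Mathlib
import HarnessLib
import Literature.Probability.LatticeModels.LatticeGreenLineEnergy

/-!
# Pick inversion, auxiliary file 1: the Poisson kernel on the circle

Helper file for stub `stub_pickInversion` of line `self-energy-pick-inversion`, crux
`PrecisionLaplacian.DirectCorrelationStableTail` (stmt-CriticalPhenomena-4799).

Elementary facts about the Poisson kernel `P_t(θ) = (1 - t²)/(1 - 2t cos θ + t²)`, `0 ≤ t < 1`,
written inline (pure theorem file, no definitions):

* `hasSum_pow_mul_cos` : `∑ tⁿ cos(nθ) = (1 - t cos θ)/(1 - 2t cos θ + t²)` (real part of the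
  geometric series of `t e^{iθ}`), and the Poisson form `hasSum_poisson_sub_one`;
* the orthogonality integrals `∫_{-π}^{π} cos(nθ) cos(mθ) dθ` and the moments
  `∫_{-π}^{π} P_t(θ) cos(mθ) dθ = 2π tᵐ` (`integral_poisson_mul_cos`);
* the uniform bound `P_t(u) ≤ P_t(δ)` for `δ ≤ |u| ≤ π` (`poisson_le_of_le_abs`), used by the
  Poisson approximate identity of the next file;
* the Chebyshev substitution `s = (λ + λ⁻¹)/2`, `λ = s - √(s² - 1) ∈ (0, 1)` for `s > 1`:
  `1/(s - cos θ) = P_λ(θ)/√(s² - 1)` and the resolvent coefficients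
  `∫_{-π}^{π} cos(mθ)/(s - cos θ) dθ = 2π λᵐ/√(s² - 1)` (`integral_cos_div_sub_cos`).

These feed the Herglotz/Pick inversion of the slab modes of the direct correlation function
(reading the Fourier coefficients of `-1/F(cos θ)` off the Nevanlinna representation).
References: standard (Katznelson, *An introduction to harmonic analysis*, Ch. I §3).
-/

noncomputable section

namespace Summit.CriticalPhenomena.Ising3DConformalLimit.Cruxes.DirectCorrelationStableTail.SelfEnergyPickInversion

open MeasureTheory Filter Topology Set Real intervalIntegral
open scoped BigOperators
open Literature.Probability.LatticeModels (integral_cos_int_mul_eq_zero)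

/-! ### Algebra of the Poisson kernel -/

/-- The denominator `1 - 2t cos θ + t²` of the Poisson kernel is positive for `|t| < 1`:
it is at least `(1 - |t|)²`. [folklore] -/
theorem poisson_den_pos {t : ℝ} (ht : |t| < 1) (θ : ℝ) : 0 < 1 - 2 * t * Real.cos θ + t ^ 2 := by
  have h1 : |t * Real.cos θ| ≤ |t| := by
    rw [abs_mul]
    exact mul_le_of_le_one_right (abs_nonneg t) (Real.abs_cos_le_one θ)
  have h2 : t * Real.cos θ ≤ |t| := le_trans (le_abs_self _) h1
  have h3 : t ^ 2 = |t| ^ 2 := (sq_abs t).symm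
  nlinarith [abs_nonneg t]

/-- The denominator of the Poisson kernel is the squared modulus `|1 - t e^{iθ}|²`. [folklore] -/
theorem poisson_den_eq_normSq (t θ : ℝ) :
    1 - 2 * t * Real.cos θ + t ^ 2 = Complex.normSq (1 - (t : ℂ) * Complex.exp (θ * Complex.I)) := by
  rw [Complex.normSq_apply]
  simp only [Complex.sub_re, Complex.one_re, Complex.re_ofReal_mul, Complex.exp_ofReal_mul_I_re,
    Complex.sub_im, Complex.one_im, Complex.im_ofReal_mul, Complex.exp_ofReal_mul_I_im, zero_sub]
  nlinarith [Real.sin_sq_add_cos_sq θ]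

/-- `∑_{n ≥ 0} tⁿ cos(nθ) = (1 - t cos θ)/(1 - 2t cos θ + t²)` for `|t| < 1` (real part of the
geometric series `∑ (t e^{iθ})ⁿ = (1 - t e^{iθ})⁻¹`). [folklore] -/
theorem hasSum_pow_mul_cos {t : ℝ} (ht : |t| < 1) (θ : ℝ) :
    HasSum (fun n : ℕ => t ^ n * Real.cos (n * θ))
      ((1 - t * Real.cos θ) / (1 - 2 * t * Real.cos θ + t ^ 2)) := by
  set ξ : ℂ := (t : ℂ) * Complex.exp (θ * Complex.I) with hξ
  have hξn : ‖ξ‖ < 1 := by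
    rw [hξ, norm_mul, Complex.norm_real, Complex.norm_exp_ofReal_mul_I, mul_one, Real.norm_eq_abs]
    exact ht
  have hgeom := hasSum_geometric_of_norm_lt_one hξn
  have hre := (Complex.reCLM.hasSum hgeom)
  have hterm : ∀ n : ℕ, Complex.reCLM (ξ ^ n) = t ^ n * Real.cos (n * θ) := by
    intro n
    rw [Complex.reCLM_apply, hξ, mul_pow, ← Complex.exp_nat_mul, ← Complex.ofReal_pow]
    have : (n : ℂ) * (θ * Complex.I) = ((n * θ : ℝ) : ℂ) * Complex.I := by push_cast; ring
    rw [this, Complex.re_ofReal_mul, Complex.exp_ofReal_mul_I_re]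
  have hlim : Complex.reCLM (1 - ξ)⁻¹ = (1 - t * Real.cos θ) / (1 - 2 * t * Real.cos θ + t ^ 2) := by
    rw [Complex.reCLM_apply, Complex.inv_re, poisson_den_eq_normSq]
    simp only [hξ, Complex.sub_re, Complex.one_re, Complex.re_ofReal_mul, Complex.exp_ofReal_mul_I_re]
  simpa [hterm, hlim] using hre

/-- The Poisson kernel minus one as a cosine series:
`∑_{n ≥ 0} 2 tⁿ⁺¹ cos((n+1)θ) = (1 - t²)/(1 - 2t cos θ + t²) - 1` for `|t| < 1`. [folklore] -/
theorem hasSum_poisson_sub_one {t : ℝ} (ht : |t| < 1) (θ : ℝ) :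
    HasSum (fun n : ℕ => 2 * t ^ (n + 1) * Real.cos ((n + 1 : ℕ) * θ))
      ((1 - t ^ 2) / (1 - 2 * t * Real.cos θ + t ^ 2) - 1) := by
  have hden := poisson_den_pos ht θ
  have h := hasSum_pow_mul_cos ht θ
  -- split off the `n = 0` term
  have h1 := (hasSum_nat_add_iff' 1).mpr h
  simp only [Finset.range_one, Finset.sum_singleton, pow_zero, Nat.cast_zero, zero_mul,
    Real.cos_zero, mul_one] at h1
  have h2 := h1.mul_left 2
  have h3 : (fun n : ℕ => 2 * t ^ (n + 1) * Real.cos ((n + 1 : ℕ) * θ)) =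
      fun i : ℕ => 2 * (t ^ (i + 1) * Real.cos ((i + 1 : ℕ) * θ)) := by
    funext i; ring
  rw [h3]
  have hden' : 1 - 2 * t * Real.cos θ + t ^ 2 ≠ 0 := hden.ne'
  have key : 2 * ((1 - t * Real.cos θ) / (1 - 2 * t * Real.cos θ + t ^ 2) - 1) =
      (1 - t ^ 2) / (1 - 2 * t * Real.cos θ + t ^ 2) - 1 := by
    rw [div_sub_one hden', div_sub_one hden', ← mul_div_assoc, div_eq_div_iff hden' hden']
    ring
  rw [key] at h2
  exact h2

/-- The Poisson kernel is nonnegative for `|t| < 1`. [folklore] -/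
theorem poisson_nonneg {t : ℝ} (ht : |t| < 1) (θ : ℝ) :
    0 ≤ (1 - t ^ 2) / (1 - 2 * t * Real.cos θ + t ^ 2) := by
  refine div_nonneg ?_ (poisson_den_pos ht θ).le
  have : t ^ 2 < 1 := by
    have := abs_nonneg t
    calc t ^ 2 = |t| ^ 2 := (sq_abs t).symm
      _ < 1 := by nlinarith
  linarith

/-- Monotonicity of the Poisson kernel away from the origin: for `0 ≤ t < 1` and `δ ≤ |u| ≤ π`
(with `0 ≤ δ`), `P_t(u) ≤ P_t(δ)`. [folklore] -/
theorem poisson_le_of_le_abs {t δ u : ℝ} (ht0 : 0 ≤ t) (ht1 : t < 1) (hδ : 0 ≤ δ) (hδu : δ ≤ |u|)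
    (hu : |u| ≤ π) :
    (1 - t ^ 2) / (1 - 2 * t * Real.cos u + t ^ 2) ≤ (1 - t ^ 2) / (1 - 2 * t * Real.cos δ + t ^ 2) := by
  have ht : |t| < 1 := by rwa [abs_of_nonneg ht0]
  have hcos : Real.cos u ≤ Real.cos δ := by
    rw [← Real.cos_abs u]
    exact Real.cos_le_cos_of_nonneg_of_le_pi hδ hu hδu
  have hnum : 0 ≤ 1 - t ^ 2 := by nlinarith
  refine div_le_div_of_nonneg_left hnum (poisson_den_pos ht δ) ?_
  nlinarith

/-! ### Orthogonality integrals on `[-π, π]` -/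

/-- `∫_{-π}^{π} cos(n θ) dθ` is `2π` for `n = 0` and `0` for a positive natural `n`
(tree lemma `integral_cos_int_mul_eq_zero`). [folklore] -/
theorem integral_cos_nat_mul (n : ℕ) :
    ∫ θ in (-π)..π, Real.cos (n * θ) = if n = 0 then 2 * π else 0 := by
  split_ifs with hn
  · subst hn; simp; ring
  · have h := integral_cos_int_mul_eq_zero (m := (n : ℤ)) (by exact_mod_cast hn)
    simpa using h

/-- Orthogonality of cosines: for naturals `n, m ≥ 1`,
`∫_{-π}^{π} cos(nθ) cos(mθ) dθ = π δ_{nm}`. [folklore] -/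
theorem integral_cos_mul_cos {n m : ℕ} (hn : 1 ≤ n) (hm : 1 ≤ m) :
    ∫ θ in (-π)..π, Real.cos (n * θ) * Real.cos (m * θ) = if n = m then π else 0 := by
  have hprod : ∀ θ : ℝ, Real.cos (n * θ) * Real.cos (m * θ) =
      (1 / 2) * Real.cos (((n : ℤ) - m : ℤ) * θ) + (1 / 2) * Real.cos (((n : ℤ) + m : ℤ) * θ) := by
    intro θ
    have h1 := Real.cos_sub (n * θ) (m * θ)
    have h2 := Real.cos_add (n * θ) (m * θ)
    push_cast
    rw [sub_mul, add_mul]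
    linarith
  simp_rw [hprod]
  rw [intervalIntegral.integral_add, intervalIntegral.integral_const_mul,
    intervalIntegral.integral_const_mul]
  · have hsum : ((n : ℤ) + m : ℤ) ≠ 0 := by omega
    rw [integral_cos_int_mul_eq_zero hsum]
    split_ifs with hnm
    · subst hnm
      simp; ring
    · have hdiff : ((n : ℤ) - m : ℤ) ≠ 0 := by omega
      rw [integral_cos_int_mul_eq_zero hdiff]; ring
  · exact (Continuous.intervalIntegrable (by fun_prop) _ _).const_mul _
  · exact (Continuous.intervalIntegrable (by fun_prop) _ _).const_mul _

/-- An odd integrand integrates to zero over `[-π, π]`: if `g` is even then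
`∫_{-π}^{π} g(θ) sin(c θ) dθ = 0`. [folklore] -/
theorem integral_even_mul_sin {g : ℝ → ℝ} (heven : ∀ θ, g (-θ) = g θ) (c : ℝ) :
    ∫ θ in (-π)..π, g θ * Real.sin (c * θ) = 0 := by
  have h := intervalIntegral.integral_comp_neg (a := -π) (b := π) (fun θ => g θ * Real.sin (c * θ))
  simp only [neg_neg] at h
  have h2 : ∫ θ in (-π)..π, g (-θ) * Real.sin (c * -θ) = -∫ θ in (-π)..π, g θ * Real.sin (c * θ) := by
    rw [← intervalIntegral.integral_neg]
    congr 1; ext θ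
    rw [heven, mul_neg, Real.sin_neg]; ring
  linarith

/-! ### Moments of the Poisson kernel -/

/-- **Moments of the Poisson kernel**: for `0 ≤ t < 1` and `m : ℕ`,
`∫_{-π}^{π} P_t(θ) cos(mθ) dθ = 2π tᵐ`. Termwise integration of the cosine series
`P_t = 1 + 2 ∑_{n ≥ 1} tⁿ cos(nθ)` (dominated by `2 ∑ tⁿ`). [folklore] -/
theorem integral_poisson_mul_cos {t : ℝ} (ht0 : 0 ≤ t) (ht1 : t < 1) (m : ℕ) :
    ∫ θ in (-π)..π, (1 - t ^ 2) / (1 - 2 * t * Real.cos θ + t ^ 2) * Real.cos (m * θ) =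
      2 * π * t ^ m := by
  have ht : |t| < 1 := by rwa [abs_of_nonneg ht0]
  -- termwise integration of `(P_t - 1) cos(mθ)`
  have hterm : HasSum (fun n : ℕ => ∫ θ in (-π)..π, 2 * t ^ (n + 1) * Real.cos ((n + 1 : ℕ) * θ) *
      Real.cos (m * θ)) (∫ θ in (-π)..π, ((1 - t ^ 2) / (1 - 2 * t * Real.cos θ + t ^ 2) - 1) *
      Real.cos (m * θ)) := by
    refine intervalIntegral.hasSum_integral_of_dominated_convergence (fun n _ => 2 * t ^ (n + 1))
      (fun n => (Continuous.aestronglyMeasurable (by fun_prop))) ?_ ?_ ?_ ?_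
    · intro n
      filter_upwards with θ _
      rw [Real.norm_eq_abs, abs_mul, abs_mul, abs_mul, abs_of_nonneg (by norm_num : (0:ℝ) ≤ 2),
        abs_of_nonneg (pow_nonneg ht0 _)]
      have h1 := Real.abs_cos_le_one ((n + 1 : ℕ) * θ)
      have h2 := Real.abs_cos_le_one (m * θ)
      have h3 : 0 ≤ 2 * t ^ (n + 1) := by positivity
      calc 2 * t ^ (n + 1) * |Real.cos ((n + 1 : ℕ) * θ)| * |Real.cos (m * θ)|
          ≤ 2 * t ^ (n + 1) * 1 * 1 := by gcongr
        _ = 2 * t ^ (n + 1) := by ring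
    · filter_upwards with θ _
      exact ((summable_geometric_of_lt_one ht0 ht1).mul_left (2 * t)).congr fun n => by ring
    · exact intervalIntegrable_const
    · filter_upwards with θ _
      exact (hasSum_poisson_sub_one ht θ).mul_right _
  -- the value of each term
  have hval : ∀ n : ℕ, ∫ θ in (-π)..π, 2 * t ^ (n + 1) * Real.cos ((n + 1 : ℕ) * θ) * Real.cos (m * θ)
      = if n + 1 = m then 2 * π * t ^ m else 0 := by
    intro n
    have : (fun θ => 2 * t ^ (n + 1) * Real.cos ((n + 1 : ℕ) * θ) * Real.cos (m * θ)) =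
        fun θ => (2 * t ^ (n + 1)) * (Real.cos ((n + 1 : ℕ) * θ) * Real.cos (m * θ)) := by
      ext θ; ring
    rw [this, intervalIntegral.integral_const_mul]
    rcases Nat.eq_zero_or_pos m with hm | hm
    · subst hm
      simp only [Nat.cast_zero, zero_mul, Real.cos_zero, mul_one, Nat.add_one_ne_zero, if_false]
      rw [integral_cos_nat_mul]
      simp
    · rw [integral_cos_mul_cos (by omega) hm]
      by_cases hnm : n + 1 = m
      · rw [if_pos hnm, if_pos hnm, ← hnm]; ring
      · rw [if_neg hnm, if_neg hnm]; ring
  have hsum2 : HasSum (fun n : ℕ => if n + 1 = m then 2 * π * t ^ m else (0 : ℝ))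
      (if m = 0 then 0 else 2 * π * t ^ m) := by
    rcases Nat.eq_zero_or_pos m with hm | hm
    · subst hm; simp
    · rw [if_neg hm.ne']
      convert hasSum_ite_eq (m - 1) (2 * π * t ^ m) using 1
      ext n
      congr 1
      apply propext; omega
  simp_rw [hval] at hterm
  have heq := hterm.unique hsum2
  -- add back the integral of `cos(mθ)`
  have hsplit : ∫ θ in (-π)..π, ((1 - t ^ 2) / (1 - 2 * t * Real.cos θ + t ^ 2) - 1) * Real.cos (m * θ)
      = (∫ θ in (-π)..π, (1 - t ^ 2) / (1 - 2 * t * Real.cos θ + t ^ 2) * Real.cos (m * θ)) -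
        ∫ θ in (-π)..π, Real.cos (m * θ) := by
    rw [← intervalIntegral.integral_sub]
    · congr 1; ext θ; ring
    · apply Continuous.intervalIntegrable
      refine Continuous.mul (Continuous.div continuous_const (by fun_prop) fun θ => ?_) (by fun_prop)
      exact (poisson_den_pos ht θ).ne'
    · exact Continuous.intervalIntegrable (by fun_prop) _ _
  rw [hsplit, integral_cos_nat_mul] at heq
  split_ifs at heq with hm
  · subst hm; simp at heq ⊢; linarith
  · linarith

/-- Total mass of the Poisson kernel: `∫_{-π}^{π} P_t(θ) dθ = 2π` for `0 ≤ t < 1`. [folklore] -/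
theorem integral_poisson {t : ℝ} (ht0 : 0 ≤ t) (ht1 : t < 1) :
    ∫ θ in (-π)..π, (1 - t ^ 2) / (1 - 2 * t * Real.cos θ + t ^ 2) = 2 * π := by
  have h := integral_poisson_mul_cos ht0 ht1 0
  simpa using h

/-! ### The Poisson kernel as an approximate identity -/

/-- The Poisson kernel is continuous in the angle (`|t| < 1`). [folklore] -/
theorem continuous_poisson {t : ℝ} (ht : |t| < 1) :
    Continuous fun θ : ℝ => (1 - t ^ 2) / (1 - 2 * t * Real.cos θ + t ^ 2) :=
  Continuous.div continuous_const (by fun_prop) fun θ => (poisson_den_pos ht θ).ne'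

/-! ### The Chebyshev substitution `s = (λ + λ⁻¹)/2` -/

/-- For `s > 1`, `λ(s) = s - √(s² - 1)` lies in `(0, 1)`. [folklore] -/
theorem cheb_lambda_mem {s : ℝ} (hs : 1 < s) :
    0 < s - Real.sqrt (s ^ 2 - 1) ∧ s - Real.sqrt (s ^ 2 - 1) < 1 := by
  have hs0 : 0 < s := by linarith
  have hpos : 0 < s ^ 2 - 1 := by nlinarith
  have hsq : Real.sqrt (s ^ 2 - 1) ^ 2 = s ^ 2 - 1 := Real.sq_sqrt hpos.le
  have hsqrt_nonneg := Real.sqrt_nonneg (s ^ 2 - 1)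
  constructor
  · -- `√(s²-1) < s` since `s² - 1 < s²`
    have : Real.sqrt (s ^ 2 - 1) < s := by
      rw [Real.sqrt_lt' hs0]; linarith
    linarith
  · -- `s - 1 < √(s²-1)` since `(s-1)² < s² - 1`
    have : s - 1 < Real.sqrt (s ^ 2 - 1) := by
      rw [Real.lt_sqrt (by linarith)]; nlinarith
    linarith

/-- The quadratic relation of the Chebyshev parameter: with `λ = s - √(s² - 1)`,
`1 + λ² = 2 λ s` and `1 - λ² = 2 λ √(s² - 1)`. [folklore] -/
theorem cheb_lambda_sq {s : ℝ} (hs : 1 < s) :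
    1 + (s - Real.sqrt (s ^ 2 - 1)) ^ 2 = 2 * (s - Real.sqrt (s ^ 2 - 1)) * s ∧
      1 - (s - Real.sqrt (s ^ 2 - 1)) ^ 2 = 2 * (s - Real.sqrt (s ^ 2 - 1)) * Real.sqrt (s ^ 2 - 1) := by
  have hpos : 0 < s ^ 2 - 1 := by nlinarith
  have hsq : Real.sqrt (s ^ 2 - 1) ^ 2 = s ^ 2 - 1 := Real.sq_sqrt hpos.le
  constructor <;> nlinarith

/-- The resolvent kernel as a Poisson kernel: for `s > 1` and `λ = s - √(s² - 1)`,
`1/(s - cos θ) = P_λ(θ)/√(s² - 1)`. [folklore] -/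
theorem inv_sub_cos_eq_poisson {s : ℝ} (hs : 1 < s) (θ : ℝ) :
    1 / (s - Real.cos θ) = (1 - (s - Real.sqrt (s ^ 2 - 1)) ^ 2) /
      (1 - 2 * (s - Real.sqrt (s ^ 2 - 1)) * Real.cos θ + (s - Real.sqrt (s ^ 2 - 1)) ^ 2) /
        Real.sqrt (s ^ 2 - 1) := by
  obtain ⟨hl0, hl1⟩ := cheb_lambda_mem hs
  obtain ⟨h1, h2⟩ := cheb_lambda_sq hs
  set l := s - Real.sqrt (s ^ 2 - 1) with hl
  have hpos : 0 < s ^ 2 - 1 := by nlinarith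
  have hsqrt : 0 < Real.sqrt (s ^ 2 - 1) := Real.sqrt_pos.mpr hpos
  have hsc : 0 < s - Real.cos θ := by linarith [Real.cos_le_one θ]
  have hden : 1 - 2 * l * Real.cos θ + l ^ 2 = 2 * l * (s - Real.cos θ) := by linear_combination h1
  rw [hden, h2]
  field_simp

/-- **Chebyshev coefficients of the resolvent**: for `s > 1`, `m : ℕ` and `λ = s - √(s² - 1)`,
`∫_{-π}^{π} cos(mθ)/(s - cos θ) dθ = 2π λᵐ/√(s² - 1)`. [folklore] -/
theorem integral_cos_div_sub_cos {s : ℝ} (hs : 1 < s) (m : ℕ) :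
    ∫ θ in (-π)..π, Real.cos (m * θ) / (s - Real.cos θ) =
      2 * π * (s - Real.sqrt (s ^ 2 - 1)) ^ m / Real.sqrt (s ^ 2 - 1) := by
  obtain ⟨hl0, hl1⟩ := cheb_lambda_mem hs
  have key : ∀ θ : ℝ, Real.cos (m * θ) / (s - Real.cos θ) =
      (1 / Real.sqrt (s ^ 2 - 1)) * ((1 - (s - Real.sqrt (s ^ 2 - 1)) ^ 2) /
        (1 - 2 * (s - Real.sqrt (s ^ 2 - 1)) * Real.cos θ + (s - Real.sqrt (s ^ 2 - 1)) ^ 2) *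
          Real.cos (m * θ)) := by
    intro θ
    rw [div_eq_mul_one_div (Real.cos (m * θ)), inv_sub_cos_eq_poisson hs θ]
    ring
  simp_rw [key]
  rw [intervalIntegral.integral_const_mul, integral_poisson_mul_cos hl0.le hl1 m]
  ring

/-- **Registered auxiliary stub `stub_pickInversion_auxPoisson`** (sub-goal of `stub_pickInversion`):
the Chebyshev coefficients of the resolvent, `∫_{-π}^{π} cos(mθ)/(s - cos θ) dθ = 2π λᵐ/√(s² - 1)`
with `λ = s - √(s² - 1)`, for every `s > 1` and `m : ℕ`. [folklore] -/
theorem stub_pickInversion_auxPoisson : ∀ s : ℝ, 1 < s → ∀ m : ℕ,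
    ∫ θ in (-Real.pi)..Real.pi, Real.cos (m * θ) / (s - Real.cos θ) =
      2 * Real.pi * (s - Real.sqrt (s ^ 2 - 1)) ^ m / Real.sqrt (s ^ 2 - 1) :=
  fun _ hs m => integral_cos_div_sub_cos hs m

/-- Total mass of the resolvent kernel: `∫_{-π}^{π} dθ/(s - cos θ) = 2π/√(s² - 1)` for `s > 1`.
[folklore] -/
theorem integral_inv_sub_cos {s : ℝ} (hs : 1 < s) :
    ∫ θ in (-π)..π, 1 / (s - Real.cos θ) = 2 * π / Real.sqrt (s ^ 2 - 1) := by
  have h := integral_cos_div_sub_cos hs 0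
  simpa using h

end Summit.CriticalPhenomena.Ising3DConformalLimit.Cruxes.DirectCorrelationStableTail.SelfEnergyPickInversion

end
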